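import Literature.NumberTheory.LFunctions.Zhang2022.Section12ShiftedContourZ22
import Literature.NumberTheory.LFunctions.Zhang2022.RepairGapExceptionalZeroPremise
import HarnessLib

/-!
# Zhang (2022), rescue GAP/BED (D-0124 (3)(4)): §12 Lemmas 12.2–12.3 — the shifted big contour AT THE MANUSCRIPT'S OBJECTS
# (`Lemma84.ShiftedContour.norm_vline_sub_circ_le_Z22`) under the minimum premise `‖L(1,χ)‖ ≤ 𝓛⁻¹⁵`

Topic `Literature/NumberTheory/LFunctions/Zhang2022` (Landau–Siegel audit tree; verdict-neutral).
Y. Zhang, *Discrete mean estimates and the Landau–Siegel zero*, arXiv:2211.02515v1 (2022)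
[Zhang2022LandauSiegel] — **an unrefereed manuscript under adjudication; nothing in this file asserts or
denies its Theorems 1–2, and nothing here is a claim about Landau–Siegel zeros. The programme SEARCHES and
TYPES; no claim about Landau–Siegel zeros, Theorems 1–2 of arXiv:2211.02515 or a repaired Margin232 until a
kernel theorem says so.**

The tree theorem `Lemma84.ShiftedContour.norm_vline_sub_circ_le_Z22` (zl-libB-p5; the big Landau contour of the proofs of Lemmas 12.2–12.3 with
the manuscript's objects: `‖(1/2π)∫_ℝ Φ(1+it)K_Y(1+it)dt − (2πi)⁻¹∮_{C(s₀,3α)} Φ·K_Y‖ ≤ C₀𝓛^{−k}`) consumes Assumption (A) ONLY through the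
exceptional-zero package `Lemma84.exceptional_package` (Lemma 5.5 + the classical zero-free region), of which it uses `1 − ρ̃ ≤ K𝓛⁻¹⁰`; the package
is kernel at (A)-exponent 15 (`Repair.Gap.exceptional_package_pow15`, bed-2 g5 p592754: `1 − ρ̃ ≤ K𝓛⁻¹⁵`). This file re-runs the theorem VERBATIM
with the hypothesis `‖L(1,χ)‖ < 𝓛⁻²⁰²²` replaced by `‖L(1,χ)‖ ≤ 𝓛⁻¹⁵` and the package re-pointed: **`norm_vline_sub_circ_le_Z22_pow15`** (same
`C₀`, same thresholds; the docstring below is the tree's). Input of the u025 assembly (leaf h1212 `Typed.Sec12C.Eq1212`) at (A)-exponent 15.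
Theorems only; no definition, no named fact; nothing about (A) itself. Private helpers of the source file copied (suffix `_z15`).

## References

* Y. Zhang, arXiv:2211.02515v1 (2022), §12 proofs of Lemmas 12.2–12.3, pp. 69–70; §8 proof of Lemma 8.4 p. 47; §5 Lemma 5.5.
  [cite: Zhang2022LandauSiegel, §12 Lemmas 12.2–12.3, pp. 69–70]
* H. L. Montgomery, R. C. Vaughan, *Multiplicative Number Theory I*, CUP 2007, §6.2. [cite: MontgomeryVaughan2007, §6.2]
-/

noncomputable section

open Complex Real Set Filter Topology MeasureTheory Metric

namespace Literature.NumberTheory.LFunctions.Zhang2022.Lemma84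

namespace ShiftedContour

open Skeleton GaussWeight GaussKernelContour

/-- `M ≤ 𝓛 = log D` for all large `D`. [folklore] -/
private theorem exists_nat_le_ell_z15 (M : ℝ) : ∃ D₀ : ℕ, ∀ D : ℕ, D₀ ≤ D → M ≤ ell D := by
  refine ⟨⌈Real.exp M⌉₊ + 1, fun D hD => ?_⟩
  have h1 : Real.exp M ≤ D := by
    have : (⌈Real.exp M⌉₊ : ℝ) + 1 ≤ D := by exact_mod_cast hD
    linarith [Nat.le_ceil (Real.exp M)]
  have hD0 : (0 : ℝ) < D := lt_of_lt_of_le (Real.exp_pos M) h1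
  rw [ell, Real.le_log_iff_exp_le hD0]
  exact h1

/-- `log x ≤ 21𝓛` for `0 < x ≤ 𝓛²⁰ + 5`, `𝓛 ≥ 1` (`𝓛²⁰ ≤ e^{20𝓛}`, `5 ≤ e^{20𝓛}`, `2 ≤ e^{𝓛}`).
[folklore] -/
private theorem log_le_of_le_pow_twenty_z15 {𝓛 x : ℝ} (h𝓛 : 1 ≤ 𝓛) (hx0 : 0 < x) (hx : x ≤ 𝓛 ^ 20 + 5) :
    Real.log x ≤ 21 * 𝓛 := by
  have h2 : 𝓛 ≤ Real.exp 𝓛 := by have := Real.add_one_le_exp 𝓛; linarith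
  have hpow : 𝓛 ^ 20 ≤ Real.exp (20 * 𝓛) := by
    calc 𝓛 ^ 20 ≤ (Real.exp 𝓛) ^ 20 := pow_le_pow_left₀ (by linarith) h2 20
      _ = Real.exp (20 * 𝓛) := by rw [← Real.exp_nat_mul]; norm_num
  have h5 : (5 : ℝ) ≤ Real.exp (20 * 𝓛) := by
    have := Real.add_one_le_exp (20 * 𝓛); linarith
  have he2 : (2 : ℝ) ≤ Real.exp 𝓛 := by
    have h := Real.add_one_le_exp (1 : ℝ)
    have : Real.exp 1 ≤ Real.exp 𝓛 := Real.exp_le_exp.2 h𝓛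
    linarith
  have hx' : x ≤ Real.exp (21 * 𝓛) := by
    calc x ≤ 𝓛 ^ 20 + 5 := hx
      _ ≤ 2 * Real.exp (20 * 𝓛) := by linarith
      _ ≤ Real.exp 𝓛 * Real.exp (20 * 𝓛) := by gcongr
      _ = Real.exp (21 * 𝓛) := by rw [← Real.exp_add]; ring_nf
  calc Real.log x ≤ Real.log (Real.exp (21 * 𝓛)) := Real.log_le_log hx0 hx'
    _ = 21 * 𝓛 := Real.log_exp _

/-- The polynomial bookkeeping: with `M_U ≤ A₁𝓛^m`, `B_L = 2(4+22𝓛) ≤ 52𝓛`, `M_inv = 22C𝓛`,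
`1 + 4/(c/(200𝓛)) ≤ 801𝓛/c`, the prefactor `M₀ + M₁ + M₂` is `≤ A₁(27 + 52²·22·C(801/c+3))·𝓛^{m+4}`, and
`𝓛^{m+4}E = (𝓛^{m+4+k}E)·𝓛^{−k}`. [folklore] -/
private theorem absorb_le_z15 {𝓛 c Cinv A₁ MU E F : ℝ} {m k : ℕ} (h𝓛 : 3 ≤ 𝓛) (hc : 0 < c)
    (hc4 : c ≤ 1 / 4) (hCinv : 0 ≤ Cinv) (hA₁ : 0 ≤ A₁) (hMU : MU ≤ A₁ * 𝓛 ^ m)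
    (hE0 : 0 ≤ E) (hEF : 𝓛 ^ (m + 4 + k) * E ≤ F) :
    (27 * MU + MU * (2 * (4 + 22 * 𝓛)) * (2 * (4 + 22 * 𝓛)) *
          (22 * Cinv * 𝓛 * (1 + 4 / (c / 200 / 𝓛))) +
        MU * (2 * (4 + 22 * 𝓛)) * (2 * (4 + 22 * 𝓛)) * (22 * Cinv * 𝓛 * 3)) * E ≤
      A₁ * (27 + 52 ^ 2 * 22 * Cinv * (801 / c + 3)) * F * (𝓛 ^ k)⁻¹ := by
  have h𝓛0 : 0 < 𝓛 := by linarith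
  have h𝓛1 : 1 ≤ 𝓛 := by linarith
  have hLm0 : 0 ≤ A₁ * 𝓛 ^ m := by positivity
  have hMU0' : MU ≤ A₁ * 𝓛 ^ m := hMU
  have hBL52 : 2 * (4 + 22 * 𝓛) ≤ 52 * 𝓛 := by linarith
  have hBL0 : 0 ≤ 2 * (4 + 22 * 𝓛) := by positivity
  have hηinv : 1 + 4 / (c / 200 / 𝓛) ≤ 801 * 𝓛 / c := by
    have e : 4 / (c / 200 / 𝓛) = 800 * 𝓛 / c := by field_simp; ring
    rw [e]
    have h1 : 1 ≤ 𝓛 / c := by rw [le_div_iff₀ hc]; linarith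
    calc 1 + 800 * 𝓛 / c ≤ 𝓛 / c + 800 * 𝓛 / c := by linarith
      _ = 801 * 𝓛 / c := by ring
  have hηinv0 : 0 ≤ 1 + 4 / (c / 200 / 𝓛) := by positivity
  have hm4 : 𝓛 ^ m ≤ 𝓛 ^ (m + 4) := pow_le_pow_right₀ h𝓛1 (by omega)
  have hm34 : 𝓛 ^ (m + 3) ≤ 𝓛 ^ (m + 4) := pow_le_pow_right₀ h𝓛1 (by omega)
  -- `MU ≥ 0` is not needed: if `MU < 0` every term on the left is `≤` its majorant anyway? No — use cases.
  rcases le_or_gt 0 MU with hMU0 | hMUneg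
  · have t1 : 27 * MU ≤ 27 * A₁ * 𝓛 ^ (m + 4) := by
      calc 27 * MU ≤ 27 * (A₁ * 𝓛 ^ m) := by gcongr
        _ ≤ 27 * (A₁ * 𝓛 ^ (m + 4)) := by gcongr
        _ = _ := by ring
    have t2 : MU * (2 * (4 + 22 * 𝓛)) * (2 * (4 + 22 * 𝓛)) *
        (22 * Cinv * 𝓛 * (1 + 4 / (c / 200 / 𝓛))) ≤
        A₁ * (52 ^ 2 * 22 * Cinv * (801 / c)) * 𝓛 ^ (m + 4) := by
      calc MU * (2 * (4 + 22 * 𝓛)) * (2 * (4 + 22 * 𝓛)) * (22 * Cinv * 𝓛 * (1 + 4 / (c / 200 / 𝓛)))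
          ≤ (A₁ * 𝓛 ^ m) * (52 * 𝓛) * (52 * 𝓛) * (22 * Cinv * 𝓛 * (801 * 𝓛 / c)) := by gcongr
        _ = A₁ * (52 ^ 2 * 22 * Cinv * (801 / c)) * 𝓛 ^ (m + 4) := by ring
    have t3 : MU * (2 * (4 + 22 * 𝓛)) * (2 * (4 + 22 * 𝓛)) * (22 * Cinv * 𝓛 * 3) ≤
        A₁ * (52 ^ 2 * 22 * Cinv * 3) * 𝓛 ^ (m + 4) := by
      calc MU * (2 * (4 + 22 * 𝓛)) * (2 * (4 + 22 * 𝓛)) * (22 * Cinv * 𝓛 * 3)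
          ≤ (A₁ * 𝓛 ^ m) * (52 * 𝓛) * (52 * 𝓛) * (22 * Cinv * 𝓛 * 3) := by gcongr
        _ = A₁ * (52 ^ 2 * 22 * Cinv * 3) * 𝓛 ^ (m + 3) := by ring
        _ ≤ A₁ * (52 ^ 2 * 22 * Cinv * 3) * 𝓛 ^ (m + 4) := by gcongr
    have hB : 27 * MU + MU * (2 * (4 + 22 * 𝓛)) * (2 * (4 + 22 * 𝓛)) *
          (22 * Cinv * 𝓛 * (1 + 4 / (c / 200 / 𝓛))) +
        MU * (2 * (4 + 22 * 𝓛)) * (2 * (4 + 22 * 𝓛)) * (22 * Cinv * 𝓛 * 3) ≤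
        A₁ * (27 + 52 ^ 2 * 22 * Cinv * (801 / c + 3)) * 𝓛 ^ (m + 4) := by
      have e : A₁ * (27 + 52 ^ 2 * 22 * Cinv * (801 / c + 3)) * 𝓛 ^ (m + 4) =
          27 * A₁ * 𝓛 ^ (m + 4) + A₁ * (52 ^ 2 * 22 * Cinv * (801 / c)) * 𝓛 ^ (m + 4) +
          A₁ * (52 ^ 2 * 22 * Cinv * 3) * 𝓛 ^ (m + 4) := by ring
      rw [e]; linarith
    have hA0 : 0 ≤ A₁ * (27 + 52 ^ 2 * 22 * Cinv * (801 / c + 3)) := by positivity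
    have hLk : 0 < 𝓛 ^ k := pow_pos h𝓛0 k
    calc _ ≤ (A₁ * (27 + 52 ^ 2 * 22 * Cinv * (801 / c + 3)) * 𝓛 ^ (m + 4)) * E :=
          mul_le_mul_of_nonneg_right hB hE0
      _ = A₁ * (27 + 52 ^ 2 * 22 * Cinv * (801 / c + 3)) * (𝓛 ^ (m + 4 + k) * E) * (𝓛 ^ k)⁻¹ := by
          field_simp; ring
      _ ≤ A₁ * (27 + 52 ^ 2 * 22 * Cinv * (801 / c + 3)) * F * (𝓛 ^ k)⁻¹ := by gcongr
  · -- `MU < 0`: the left side is `≤ 0 ≤` the right side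
    have hF : 0 ≤ F := le_trans (by positivity) hEF
    have hneg : 27 * MU + MU * (2 * (4 + 22 * 𝓛)) * (2 * (4 + 22 * 𝓛)) *
          (22 * Cinv * 𝓛 * (1 + 4 / (c / 200 / 𝓛))) +
        MU * (2 * (4 + 22 * 𝓛)) * (2 * (4 + 22 * 𝓛)) * (22 * Cinv * 𝓛 * 3) ≤ 0 := by
      have h1 : 0 ≤ (2 * (4 + 22 * 𝓛)) * (2 * (4 + 22 * 𝓛)) *
          (22 * Cinv * 𝓛 * (1 + 4 / (c / 200 / 𝓛))) := by positivity
      have h2 : 0 ≤ (2 * (4 + 22 * 𝓛)) * (2 * (4 + 22 * 𝓛)) * (22 * Cinv * 𝓛 * 3) := by positivity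
      have e : 27 * MU + MU * (2 * (4 + 22 * 𝓛)) * (2 * (4 + 22 * 𝓛)) *
            (22 * Cinv * 𝓛 * (1 + 4 / (c / 200 / 𝓛))) +
          MU * (2 * (4 + 22 * 𝓛)) * (2 * (4 + 22 * 𝓛)) * (22 * Cinv * 𝓛 * 3) =
          MU * (27 + (2 * (4 + 22 * 𝓛)) * (2 * (4 + 22 * 𝓛)) *
            (22 * Cinv * 𝓛 * (1 + 4 / (c / 200 / 𝓛))) +
            (2 * (4 + 22 * 𝓛)) * (2 * (4 + 22 * 𝓛)) * (22 * Cinv * 𝓛 * 3)) := by ring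
      rw [e]
      exact mul_nonpos_of_nonpos_of_nonneg hMUneg.le (by positivity)
    calc _ ≤ 0 := mul_nonpos_of_nonpos_of_nonneg hneg hE0
      _ ≤ _ := by positivity

set_option maxHeartbeats 400000 in
/-- **The shifted big contour of Lemmas 12.2–12.3 at the manuscript's objects** (see the module
docstring): for `C₈₃ ≥ 0`, `k : ℕ` there are `C₀ ≥ 0`, `D₀` such that for `D ≥ D₀`, `χ ≠ χ₀` with (A), any
continuation `U` with Lemma 8.3's clauses (i) and (iii) (`log n ≤ 𝓛⁹`), purely imaginary `β_a, β_b`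
(`‖·‖ ≤ 1/2`), `‖s₀‖ ≤ 5α/2`, `Im s₀ ≠ 0`, `T ≤ Y ≤ P`:
`‖(1/2π)∫_ℝ Φ(1+it)K_Y(1+it)dt − (2πi)⁻¹∮_{C(s₀,3α)} Φ·K_Y‖ ≤ C₀𝓛^{−k}`, `K_Y(s) = Y^sω₁(s)/s`,
`ω₁ = omega1 (𝓛³⁰)`. One call of `norm_vline_sub_circ_le_eps1` (`c₁ = c/200`) with
`M_U ≤ A₁𝓛^m` (`frakM_le`), `B_L = 2(4 + 22𝓛)`, `M_inv = 22C𝓛`, then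
`𝓛^{m+4+k}e^{−(c₁/2)𝓛^{1/10}} ≤ (10(m+4+k))!/(c₁/2)^{10(m+4+k)}` (`pow_mul_exp_neg_tenth_le`).
[cite: Zhang2022LandauSiegel, §12 proofs of Lemmas 12.2–12.3, pp. 69–70] [cite: MontgomeryVaughan2007, §6.2] -/
theorem norm_vline_sub_circ_le_Z22_pow15 {C₈₃ : ℝ} (hC₈₃ : 0 ≤ C₈₃) (k : ℕ) :
    ∃ C₀ : ℝ, 0 ≤ C₀ ∧ ∃ D₀ : ℕ, ∀ ⦃D : ℕ⦄ [NeZero D], D₀ ≤ D →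
      ∀ (χ : DirichletCharacter ℂ D), χ ≠ 1 → ‖χ.LFunction 1‖ ≤ 1 / Real.log D ^ 15 →
      ∀ (U Φ : ℂ → ℂ) (s₀ βa βb : ℂ) ⦃n : ℕ⦄ ⦃Y : ℝ⦄, n ≠ 0 → Real.log n ≤ Real.log D ^ 9 →
      DifferentiableOn ℂ U {s : ℂ | 9 / 10 < s.re} →
      (∀ s : ℂ, 9 / 10 < s.re →
        ‖U s‖ ≤ C₈₃ * ∏ q ∈ n.primeFactors, (1 + C₈₃ * (q : ℝ) ^ (-s.re))) →
      βa.re = 0 → ‖βa‖ ≤ 1 / 2 → βb.re = 0 → ‖βb‖ ≤ 1 / 2 →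
      ‖s₀‖ ≤ 5 * alpha D / 2 → s₀.im ≠ 0 →
      (∀ s, Φ s = U (1 - s₀ + s) * χ.LFunction (1 - s₀ + s + βa) *
        χ.LFunction (1 - s₀ + s + βb) / χ.LFunction (1 - s₀ + s)) →
      bigT D ≤ Y → Y ≤ bigP D →
      ‖(1 / (2 * π) : ℂ) * (∫ t : ℝ, Φ (((1 : ℝ) : ℂ) + t * I) *
            ((Y : ℂ) ^ (((1 : ℝ) : ℂ) + t * I + 0) * omega1 (ell D ^ 30) (((1 : ℝ) : ℂ) + t * I + 0) /
              (((1 : ℝ) : ℂ) + t * I + 0))) -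
          (2 * π * I)⁻¹ * (∮ z in C(s₀, 3 * alpha D), Φ z *
            ((Y : ℂ) ^ (z + 0) * omega1 (ell D ^ 30) (z + 0) / (z + 0)))‖ ≤ C₀ * (ell D ^ k)⁻¹ := by
  obtain ⟨c, hc, hc4, Cinv, hCinv, K, hK, D₁, hpk⟩ := Repair.Gap.exceptional_package_pow15
  -- constants
  set c₁ : ℝ := c / 200 with hc₁def
  have hc₁ : 0 < c₁ := by positivity
  have hc₁1 : c₁ ≤ 1 := by rw [hc₁def]; linarith
  obtain ⟨D₂, hD₂⟩ := norm_vline_sub_circ_le_eps1 hc₁ hc₁1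
  set m : ℕ := ⌈2 * C₈₃⌉₊ with hm
  set A₁ : ℝ := C₈₃ * (Real.exp (8 * C₈₃ + 4 * C₈₃ * ((Nat.factorial 9 : ℝ) / 2 ^ 9)) * 2 ^ m)
    with hA₁
  have hA₁0 : 0 ≤ A₁ := by positivity
  set A₂ : ℝ := A₁ * (27 + 52 ^ 2 * 22 * Cinv * (801 / c + 3)) with hA₂
  have hA₂0 : 0 ≤ A₂ := by positivity
  set C₀ : ℝ := A₂ * (((10 * (m + 4 + k)).factorial : ℝ) / (c₁ / 2) ^ (10 * (m + 4 + k))) with hC₀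
  have hC₀0 : 0 ≤ C₀ := by positivity
  -- the threshold
  set Lmax : ℝ := max (max 3 (5000 * π / c)) (max (800 * K / c) (K + 1)) with hLmax
  obtain ⟨D₃, hD₃⟩ := exists_nat_le_ell_z15 Lmax
  refine ⟨C₀, hC₀0, max (max D₁ D₂) D₃, ?_⟩
  intro D _ hD χ hχ1 hA U Φ s₀ βa βb n Y hn hnP hUd hUbd hβa hβa1 hβb hβb1 hs₀ hs₀im hΦ hTY hYP
  have hD₁D : D₁ ≤ D := le_trans (le_trans (le_max_left _ _) (le_max_left _ _)) hD
  have hD₂D : D₂ ≤ D := le_trans (le_trans (le_max_right _ _) (le_max_left _ _)) hD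
  have hLm : Lmax ≤ ell D := hD₃ D (le_trans (le_max_right _ _) hD)
  set 𝓛 : ℝ := ell D with h𝓛def
  have h𝓛log : Real.log D = 𝓛 := rfl
  have h𝓛3 : 3 ≤ 𝓛 := le_trans (by simp [hLmax]) hLm
  have hL5000 : 5000 * π / c ≤ 𝓛 := le_trans (by simp [hLmax]) hLm
  have hL800 : 800 * K / c ≤ 𝓛 := le_trans (by simp [hLmax]) hLm
  have hLK1 : K + 1 ≤ 𝓛 := le_trans (by simp [hLmax]) hLm
  have h𝓛0 : 0 < 𝓛 := by linarith
  have h𝓛1 : 1 ≤ 𝓛 := by linarith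
  have hπ0 := Real.pi_pos
  have hπ3 := Real.pi_gt_three
  -- parameters
  set α : ℝ := alpha D with hαdef
  have hαeq : α = π / 𝓛 ^ 9 := by rw [hαdef, alpha, bigP, Real.log_exp]
  have hα0 : 0 < α := by rw [hαeq]; positivity
  set η : ℝ := c₁ / 𝓛 with hηdef
  have hηc : η = c / (200 * 𝓛) := by rw [hηdef, hc₁def]; ring
  have hη0 : 0 < η := by positivity
  -- `55α ≤ η`: gives `5α/2 ≤ η/10` and `‖s₀‖ + 3α ≤ 11α/2 ≤ η`
  have hαη : 55 * α ≤ η := by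
    rw [hαeq, hηc, show 55 * (π / 𝓛 ^ 9) = 55 * π / 𝓛 ^ 9 by ring,
      div_le_div_iff₀ (by positivity) (by positivity)]
    have h1 : 5000 * π ≤ c * 𝓛 := by rw [div_le_iff₀ hc] at hL5000; linarith
    have h37 : (3 : ℝ) ≤ 𝓛 ^ 7 :=
      le_trans (by norm_num : (3 : ℝ) ≤ 3 ^ 7) (pow_le_pow_left₀ (by norm_num) h𝓛3 7)
    have h8 : 3 * 𝓛 ≤ 𝓛 ^ 8 := by
      calc 3 * 𝓛 = 𝓛 * 3 := by ring
        _ ≤ 𝓛 * 𝓛 ^ 7 := by gcongr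
        _ = 𝓛 ^ 8 := by ring
    have hπ𝓛 : 0 ≤ π * 𝓛 := by positivity
    calc 55 * π * (200 * 𝓛) = 11000 * (π * 𝓛) := by ring
      _ ≤ 15000 * (π * 𝓛) := by gcongr; norm_num
      _ = (5000 * π) * (3 * 𝓛) := by ring
      _ ≤ (c * 𝓛) * 𝓛 ^ 8 := mul_le_mul h1 h8 (by positivity) (by positivity)
      _ = c * 𝓛 ^ 9 := by ring
  have hη40 : η ≤ 1 / 40 := by
    rw [hηc, div_le_iff₀ (by positivity)]; linarith
  have hs₀η : ‖s₀‖ ≤ η / 10 := by linarith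
  -- the exceptional zero and the zero-free package
  obtain ⟨ρ, hρ1, hρK, hLρ, hL'ρ, hzfp⟩ := hpk D χ hD₁D hχ1 hA
  have hKρ : 1 - ρ ≤ K / 𝓛 ^ 10 := by
    refine hρK.trans ?_
    rw [← div_eq_mul_inv, h𝓛log]
    exact div_le_div_of_nonneg_left hK.le (by positivity) (pow_le_pow_right₀ h𝓛1 (by norm_num))
  have hρη : 1 - η / 4 ≤ ρ := by
    have h1 : K / 𝓛 ^ 10 ≤ c / (800 * 𝓛) := by
      rw [div_le_div_iff₀ (by positivity) (by positivity)]
      have h800 : 800 * K ≤ c * 𝓛 := by rw [div_le_iff₀ hc] at hL800; linarith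
      have h9 : 𝓛 ≤ 𝓛 ^ 9 := le_self_pow₀ h𝓛1 (by norm_num)
      calc K * (800 * 𝓛) = (800 * K) * 𝓛 := by ring
        _ ≤ (c * 𝓛) * 𝓛 ^ 9 := by gcongr
        _ = c * 𝓛 ^ 10 := by ring
    have : η / 4 = c / (800 * 𝓛) := by rw [hηc]; ring
    linarith
  set sρ : ℂ := ((ρ - 1 : ℝ) : ℂ) + s₀ with hsρdef
  have hsρ0 : sρ ≠ 0 := by
    intro h
    have := congrArg Complex.im h
    simp [hsρdef] at this
    exact hs₀im this
  -- the circle `C(s₀, 3α)`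
  have hcR : ‖s₀‖ + 3 * alpha D ≤ η := by rw [← hαdef]; linarith
  have h0ball : (0 : ℂ) ∈ ball s₀ (3 * alpha D) := by
    rw [mem_ball, dist_comm, dist_zero_right, ← hαdef]; linarith
  have hρball : sρ ∈ ball s₀ (3 * alpha D) := by
    rw [mem_ball, dist_eq_norm, ← hαdef]
    have h1 : sρ - s₀ = ((ρ - 1 : ℝ) : ℂ) := by rw [hsρdef]; ring
    rw [h1, Complex.norm_real, Real.norm_eq_abs, abs_of_nonpos (by linarith)]
    -- `1 − ρ ≤ K/𝓛¹⁰ < 3π/𝓛⁹ = 3α`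
    have h2 : K / 𝓛 ^ 10 < 3 * (π / 𝓛 ^ 9) := by
      rw [show 3 * (π / 𝓛 ^ 9) = 3 * π / 𝓛 ^ 9 by ring,
        div_lt_div_iff₀ (by positivity) (by positivity)]
      have hK3 : K < 3 * π * 𝓛 := by
        calc K < K + 1 := by linarith
          _ ≤ 𝓛 := hLK1
          _ ≤ 3 * π * 𝓛 := le_mul_of_one_le_left h𝓛0.le (by linarith)
      calc K * 𝓛 ^ 9 < (3 * π * 𝓛) * 𝓛 ^ 9 := mul_lt_mul_of_pos_right hK3 (by positivity)
        _ = 3 * π * 𝓛 ^ 10 := by ring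
    rw [hαeq]; linarith
  -- `M_U`: the Euler-product majorant on `Re w ≥ 1 − 2η`
  set MU : ℝ := C₈₃ * Real.exp (2 * C₈₃ * (Real.log (2 * Real.log D) + 4) +
    4 * C₈₃ * Real.log D ^ 9 / (D : ℝ) ^ 2) with hMUdef
  have hMU0 : 0 ≤ MU := by positivity
  have hU : ∀ w : ℂ, 1 - 2 * η ≤ w.re → ‖U w‖ ≤ MU := by
    intro w hw
    have hw9 : 9 / 10 < w.re := by linarith
    have hηL : 2 * (2 * η) * Real.log D ≤ 1 / 4 := by
      rw [h𝓛log, hηc]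
      have e : 2 * (2 * (c / (200 * 𝓛))) * 𝓛 = c / 50 := by field_simp; ring
      rw [e]; linarith
    have hprod := prod_primeFactors_le (D := D) (n := n) (by rw [h𝓛log]; linarith) hn hnP
      hC₈₃ (by positivity : (0 : ℝ) ≤ 2 * η) hηL (σ := w.re) (by linarith)
    exact (hUbd w hw9).trans (mul_le_mul_of_nonneg_left hprod hC₈₃)
  have hMUle : MU ≤ A₁ * 𝓛 ^ m := by
    have h := frakM_le (D := D) hC₈₃ (by rw [h𝓛log]; exact h𝓛1)
    rw [hMUdef, hA₁]
    calc C₈₃ * Real.exp (2 * C₈₃ * (Real.log (2 * Real.log D) + 4) +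
          4 * C₈₃ * Real.log D ^ 9 / (D : ℝ) ^ 2)
        ≤ C₈₃ * (Real.exp (8 * C₈₃ + 4 * C₈₃ * ((Nat.factorial 9 : ℝ) / 2 ^ 9)) * 2 ^ ⌈2 * C₈₃⌉₊ *
            Real.log D ^ ⌈2 * C₈₃⌉₊) := mul_le_mul_of_nonneg_left h hC₈₃
      _ = _ := by rw [hm, h𝓛log]; ring
  -- `B_L`: `‖L(w,χ)‖ ≤ 2(4 + 22𝓛)` for `Re w ≥ 1 − 2η`, `‖w‖ ≤ 𝓛²⁰ + 4`
  have hBL : ∀ w : ℂ, 1 - 2 * η ≤ w.re → ‖w‖ ≤ 𝓛 ^ 20 + 4 →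
      ‖χ.LFunction w‖ ≤ 2 * (4 + 22 * 𝓛) := by
    intro w hw hwn
    have hls : Real.log (‖w‖ + 1) ≤ 21 * 𝓛 :=
      log_le_of_le_pow_twenty_z15 h𝓛1 (by positivity) (by linarith)
    have hl0 : 0 ≤ Real.log (‖w‖ + 1) := Real.log_nonneg (by linarith [norm_nonneg w])
    have h := norm_LFunction_le_near_one χ hχ1 (η := 2 * η) (by linarith) hw (by
      rw [h𝓛log]
      calc 2 * η * (𝓛 + Real.log (‖w‖ + 1)) ≤ 2 * η * (𝓛 + 21 * 𝓛) := by gcongr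
        _ = 44 * c / 200 := by rw [hηc]; field_simp; ring
        _ ≤ 1 / 8 := by linarith)
    rw [h𝓛log] at h
    linarith
  -- `M_inv`: the zero-free package on `Re w ≥ 1 − 2η`, `|Im w| ≤ 𝓛²⁰ + 1`
  have hpack : ∀ w : ℂ, 1 - 2 * η ≤ w.re → |w.im| ≤ 𝓛 ^ 20 + 1 → w ≠ (ρ : ℂ) →
      χ.LFunction w ≠ 0 ∧ ‖(χ.LFunction w)⁻¹‖ ≤ 22 * Cinv * 𝓛 * (1 + ‖w - ρ‖⁻¹) := by
    intro w hw him hne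
    have hls : Real.log (|w.im| + 4) ≤ 21 * 𝓛 :=
      log_le_of_le_pow_twenty_z15 h𝓛1 (by positivity) (by linarith)
    have hl0 : 0 ≤ Real.log (|w.im| + 4) := Real.log_nonneg (by linarith [abs_nonneg w.im])
    have hsum0 : 0 < Real.log D + Real.log (|w.im| + 4) := by rw [h𝓛log]; linarith
    have hre : 1 - c / (Real.log D + Real.log (|w.im| + 4)) ≤ w.re := by
      have h1 : 2 * η ≤ c / (Real.log D + Real.log (|w.im| + 4)) := by
        rw [le_div_iff₀ hsum0, h𝓛log, hηc]
        have : 2 * (c / (200 * 𝓛)) * (𝓛 + Real.log (|w.im| + 4)) ≤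
            2 * (c / (200 * 𝓛)) * (22 * 𝓛) := by gcongr; linarith
        have e : 2 * (c / (200 * 𝓛)) * (22 * 𝓛) = 44 * c / 200 := by field_simp; ring
        linarith
      linarith
    obtain ⟨hne0, hb⟩ := hzfp w hre hne
    refine ⟨hne0, hb.trans ?_⟩
    have : Cinv * (Real.log D + Real.log (|w.im| + 4)) ≤ 22 * Cinv * 𝓛 := by
      rw [h𝓛log]
      calc Cinv * (𝓛 + Real.log (|w.im| + 4)) ≤ Cinv * (𝓛 + 21 * 𝓛) := by gcongr
        _ = 22 * Cinv * 𝓛 := by ring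
    exact mul_le_mul_of_nonneg_right this (by positivity)
  -- the contour bound at the scales
  have hmain := hD₂ hD₂D χ U Φ s₀ βa βb (ρ := ρ) (Y := Y) (MU := MU) (BL := 2 * (4 + 22 * 𝓛))
    (Minv := 22 * Cinv * 𝓛) (c := s₀) (R := 3 * alpha D) hχ1 hTY hYP hs₀η hβa hβa1 hβb hβb1 hUd hΦ
    hMU0 hU (by positivity) hBL (by positivity) hpack hρ1 hρη hLρ hL'ρ hsρ0 hcR h0ball hρball
  refine hmain.trans ?_
  -- absorption of the polynomial factors
  have hpow : 𝓛 ^ (m + 4 + k) * Real.exp (-(c₁ / 2) * ell D ^ (1 / 10 : ℝ)) ≤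
      ((10 * (m + 4 + k)).factorial : ℝ) / (c₁ / 2) ^ (10 * (m + 4 + k)) := by
    have h := pow_mul_exp_neg_tenth_le (a := c₁ / 2) (L := 𝓛) (by positivity) h𝓛0.le (m + 4 + k)
    have e : Real.exp (-(c₁ / 2) * ell D ^ (1 / 10 : ℝ)) = Real.exp (-(c₁ / 2 * 𝓛 ^ (1 / 10 : ℝ))) := by
      rw [← h𝓛def, neg_mul]
    rwa [e]
  have h := absorb_le_z15 (k := k) h𝓛3 hc hc4 hCinv hA₁0 hMUle (Real.exp_pos _).le hpow
  refine h.trans (le_of_eq ?_)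
  rw [hC₀, hA₂, h𝓛def]

end ShiftedContour

end Literature.NumberTheory.LFunctions.Zhang2022.Lemma84

end
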